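import Mathlib
import Summits.Ventures.PercRepro.TriangleCapBandNoGap
import Summits.Ventures.PercRepro.TriangleCapDeepRows

/-!
# PercRepro — THE SUB-BAND BOUND FOR THE MAXIMUM OFF-DEGREE: THE TWO SEMANTICS AGREE ON THE BOUNDS
(p3, gen 54; part 293)

The sub-band `u` of the census (§10df(a)) is the set of band values of the graphs whose off-edge graph has MAXIMUM
degree exactly `t − u`; the tree's sub-band theorems (parts 252, 257) take a NON-NEIGHBOUR of off-degree `t − u`.
The two agree whenever some non-neighbour attains the maximum; the remaining case — the maximum `t − u` attained
only at neighbours of `w` (then `t − u ≤ ℓ`, every non-neighbour has off-degree `< t − u`) — satisfies the same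
upper bound: the pair count is at least `(t − u)(t − u − 1)` from the maximal neighbour plus the tangent line over
ALL `ℓ` non-neighbours at `q = subQ ℓ u`, and `q (q + 1) ≤ 2 q (t − u)` (as `q ≤ t − u`) closes the gap.
THEOREM (`subband_upper_bound_max`): for every graph with every off-degree `≤ t − u` and some vertex of off-degree
`t − u` (`2 ≤ ℓ = |nonNbrs|`, `1 ≤ u`, `u + 1 ≤ t`): `2 j ≤ 2 u (t − u − 1) + twoW ℓ u`; with part 252's lower bound
(`subband_lower_bound`, any vertex of off-degree `t − u`) the sub-band `u` of the census lies in the interval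
`[B(u), B(u) + W(u, ℓ)]` for EVERY `u` (`subband_bounds_max`).  Axioms: standard.
-/

namespace PercRepro

namespace TriangleCap

namespace C047

open Finset

variable {V : Type*} [Fintype V] [DecidableEq V]

/-- `Σ_{x ∈ L} offDeg x = t + |inside|`. -/
theorem sum_offDeg_nonNbrs_eq_add_inside (H : SimpleGraph V) [DecidableRel H.Adj] (hfree : H.CliqueFree 3) (w : V) :
    ∑ x ∈ nonNbrs H w, offDeg H w x = (offEdges H w).card + (insideEdges H w).card := by
  have h1 := sum_offDeg_nonNbrs_eq H w
  have h2 := attach_add_card_inside H hfree w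
  omega

/-- **THE SUB-BAND BOUND FOR THE MAXIMUM OFF-DEGREE:** with `ℓ = |nonNbrs| ≥ 2`, `1 ≤ u`, `u + 1 ≤ t`, every
off-degree `≤ t − u` and some vertex of off-degree `t − u`: `2 j ≤ 2 u (t − u − 1) + twoW ℓ u`. -/
theorem subband_upper_bound_max (H : SimpleGraph V) [DecidableRel H.Adj] (hfree : H.CliqueFree 3) (s t u j : ℕ)
    (hs : H.edgeFinset.card = s) (w : V) (hw : deg H w + t = s) (hw1 : 1 ≤ deg H w)
    (hj : ∑ v, deg H v * deg H v + 2 * (t * (s - t - 1)) + 2 * j = s * (s + 1))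
    (hD : ∀ v, offDeg H w v + u ≤ t) (x : V) (hx : offDeg H w x + u = t) (hu : 1 ≤ u) (hut : u + 1 ≤ t)
    (hℓ : 2 ≤ (nonNbrs H w).card) :
    2 * j ≤ 2 * (u * (t - u - 1)) + twoW (nonNbrs H w).card u := by
  have htE : (offEdges H w).card = t := by
    have := card_offEdges_add_deg H w
    omega
  by_cases hxL : x ∈ nonNbrs H w
  · rw [mem_nonNbrs] at hxL
    have hq : 1 ≤ subQ (nonNbrs H w).card u := le_max_left 1 _
    have hub := subband_upper_bound H hfree s t u j hs w hw1 htE hj x hx hxL.2 hut _ hq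
    exact width_of_tangent (nonNbrs H w).card t u j hℓ hub
  · -- the maximum is attained only at neighbours of `w`
    have hxw : x ≠ w := by
      intro h
      rw [h, offDeg_self] at hx
      omega
    have hadj : H.Adj w x := by
      by_contra h
      exact hxL ((mem_nonNbrs H w x).mpr ⟨hxw, h⟩)
    set ℓ := (nonNbrs H w).card with hℓdef
    set q := subQ ℓ u with hqdef
    have hq : 1 ≤ q := le_max_left 1 _
    have hval := (layer_value_iff H s t j hs w hw1 htE).mp hj
    have hatt := attach_add_card_inside H hfree w
    rw [htE] at hatt
    have hS := sum_offDeg_nonNbrs_eq_add_inside H hfree w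
    rw [htE] at hS
    have hP := offAdjPairs_ge_insert H w x (nonNbrs H w) hxw (by
      rw [mem_nonNbrs]
      exact fun h => h.1 rfl) hxL
    have htan := two_mul_sum_le (nonNbrs H w) (offDeg H w ·) q
    rw [hS, ← hℓdef] at htan
    have htw := twoW_eq_subQ ℓ u hℓ hu
    rw [← hqdef] at htw
    have hid := subband_identity t u hut
    -- `q ≤ t − u`: every non-neighbour has off-degree `≤ t − u`, so `t ≤ ℓ (t − u)` and `u ≤ (ℓ − 1)(t − u)`
    have hsumL : t ≤ ∑ x ∈ nonNbrs H w, offDeg H w x := by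
      have := sum_offDeg_nonNbrs_ge H hfree w
      rw [htE] at this
      exact this
    have hle : ∑ x ∈ nonNbrs H w, offDeg H w x ≤ ∑ _x ∈ nonNbrs H w, (t - u) :=
      sum_le_sum (fun v _ => by have := hD v; omega)
    rw [sum_const, smul_eq_mul, ← hℓdef] at hle
    have hqD : q ≤ t - u := by
      rw [hqdef]
      unfold subQ
      have h1 : u / (ℓ - 1) ≤ t - u := by
        apply Nat.div_le_of_le_mul
        have : ℓ * (t - u) = (ℓ - 1) * (t - u) + (t - u) := by
          rw [Nat.sub_one_mul]
          have := Nat.le_mul_of_pos_left (t - u) (show 0 < ℓ by omega)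
          omega
        omega
      have h2 : 1 ≤ t - u := by omega
      exact max_le h2 h1
    have hkey : q * (q + 1) ≤ 2 * (q * (t - u)) := by
      have : q + 1 ≤ 2 * (t - u) := by omega
      calc q * (q + 1) ≤ q * (2 * (t - u)) := Nat.mul_le_mul_left q this
        _ = 2 * (q * (t - u)) := by ring
    -- the pieces as atoms
    have hmulsub : q * (t - u) + q * u = q * t := by
      rw [← Nat.mul_add]
      congr 1
      omega
    have hqI : (insideEdges H w).card ≤ q * (insideEdges H w).card := Nat.le_mul_of_pos_left _ hq
    have hmuladd : q * (t + (insideEdges H w).card) = q * t + q * (insideEdges H w).card := Nat.mul_add q t _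
    have hℓqq : (ℓ - 1) * (q * (q + 1)) + q * (q + 1) = ℓ * (q * (q + 1)) := by
      rw [Nat.sub_one_mul]
      have := Nat.le_mul_of_pos_left (q * (q + 1)) (show 0 < ℓ by omega)
      omega
    have hx' : offDeg H w x * (offDeg H w x - 1) = (t - u) * (t - u - 1) := by
      have : offDeg H w x = t - u := by omega
      rw [this]
    rw [hx'] at hP
    rw [hmuladd] at htan
    have htt : t * (t + 1) = t * (t - 1) + 2 * t := by
      obtain ⟨t', rfl⟩ : ∃ t', t = t' + 1 := ⟨t - 1, by omega⟩
      rw [Nat.add_sub_cancel]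
      ring
    omega

/-- **THE SUB-BAND `u` OF THE CENSUS LIES IN `[B(u), B(u) + W(u, ℓ)]` FOR EVERY `u`:** with every off-degree
`≤ t − u` and some vertex of off-degree `t − u` (`2 ≤ ℓ`, `1 ≤ u`, `u + 1 ≤ t`),
`u (t − u − 1) ≤ j` and `2 j ≤ 2 u (t − u − 1) + twoW ℓ u`. -/
theorem subband_bounds_max (H : SimpleGraph V) [DecidableRel H.Adj] (hfree : H.CliqueFree 3) (s t u j : ℕ)
    (hs : H.edgeFinset.card = s) (w : V) (hw : deg H w + t = s) (hw1 : 1 ≤ deg H w)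
    (hj : ∑ v, deg H v * deg H v + 2 * (t * (s - t - 1)) + 2 * j = s * (s + 1))
    (hD : ∀ v, offDeg H w v + u ≤ t) (x : V) (hx : offDeg H w x + u = t) (hu : 1 ≤ u) (hut : u + 1 ≤ t)
    (hℓ : 2 ≤ (nonNbrs H w).card) :
    u * (t - u - 1) ≤ j ∧ 2 * j ≤ 2 * (u * (t - u - 1)) + twoW (nonNbrs H w).card u :=
  ⟨subband_lower_bound' H hfree s t u j hs w hw1 hw hj x hx,
    subband_upper_bound_max H hfree s t u j hs w hw hw1 hj hD x hx hu hut hℓ⟩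

end C047

end TriangleCap

end PercRepro
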